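import Mathlib
import Summits.NavierStokesRegularity.NavierStokesRegularity.Theorems.LevelSetModerationHighSpeedPressureWorkFourThreshold
import Literature.Analysis.FluidPDE.ClassicalOvershootBound

/-!
# Route LevelSetModeration — `HighSpeedPressureWork`: the margin form — every threshold above `2B₀` is exactly class-uniform boundedness

Support file for item stmt-NavierStokesRegularity-18149 (`HighSpeedPressureWork`). Sharpening of
`…HighSpeedPressureWorkFourThreshold`: for EVERY margin `θ > 0`, write `crux_θ` for the crux with
the window condition `2B₀ ≤ M` replaced by `2(1+θ)B₀ ≤ M` (levels `c ≥ (1+θ)B₀`). Then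

  `crux_θ ↔ UniformBound`   (`levelSetModeration_highSpeedPressureWorkMargin_iff_uniformBound`),

so the ONLY content of the crux as filed beyond quantitative regularity of the data class is the
behaviour of the level-set pairing at levels `c ↓ B₀ = sup|u₀|` (margin zero) during the early
time window.

Mechanism of the new direction `UniformBound → crux_θ`
(`levelSetModeration_bookkeepingWithMargin`): under the class bound `|u| ≤ G₀` the speed overshoots
its initial maximum only by `C_o G₀² √(τ/ν)` (`exists_norm_le_initial_add_of_speed_le`), so the fast
set `{|u τ| > c}`, `c ≥ (1+θ)B₀`, is empty unless `τ > θ²B₀²ν/(C_o²G₀⁴) ≥ ν/G'²`,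
`G' = max(G₀, C_oG₀²/(θB₀))`; after the delay `ν/G'²` the normalised pressure is bounded pointwise
(`levelSetModeration_exists_pressureSupBound_delay` with `d = 1` and the weakened speed bound `G'`),
and a pointwise pressure bound on the fast set gives the pairing bound
(`levelSetModeration_pairing_le_of_pressureBound`). The direction `crux_θ → UniformBound` is the
area-law closure applied with datum bound `(1+θ)·max(B₀,1)`.
-/

noncomputable section

-- single-conjunct summit: `Summit.<Summit>.<Problem>` repeats the name by the D-0017 layout
set_option linter.dupNamespace false

namespace Summit.NavierStokesRegularity.NavierStokesRegularity.Theorems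

open MeasureTheory Set Filter Topology Function
open scoped ENNReal
open Literature.Analysis.FluidPDE
open Summit.NavierStokesRegularity.NavierStokesRegularity.Theses.LevelSetModeration

/-! ### The bookkeeping with margin `θ` -/

/-- **Bounded pairing bookkeeping with margin.** On a fibre `(ν,T)` with a class-uniform speed
bound `|u| ≤ G(E₀,B₀)` on `[0,T) × ℝ³`, for every `θ > 0` there is `F` such that every member of
the class satisfies the crux's pairing bound without the `M`-factor on all windows
`M ≥ 2(1+θ)B₀`, `c ∈ [M/2,M]`, `c > 0`, `t ∈ [0,T)`. (Fast points above `(1+θ)B₀` need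
`τ > ν/G'²`, `G' = max(G₀, C_o G₀²/(θB₀))`, by the overshoot bound; there `|p̃| ≤ K(E₀,B₀)`.)
[folklore] -/
theorem levelSetModeration_bookkeepingWithMargin :
    ∀ (ν T : ℝ), 0 < ν → 0 < T → ∀ G : ℝ → ℝ → ℝ, (∀ (u : ℝ → EuclideanSpace ℝ (Fin 3) → EuclideanSpace ℝ (Fin 3)) (p : ℝ → EuclideanSpace ℝ (Fin 3) → ℝ), Literature.Analysis.FluidPDE.IsClassicalNSSolutionOn (Set.Ico 0 T) ν 0 u p → Literature.Analysis.FluidPDE.IsLerayHopfOn T ν 0 (u 0) u → Literature.Analysis.FluidPDE.HasRapidSpatialDecay (u 0) → ∀ (E₀ B₀ : ℝ), (∫ x, ‖u 0 x‖ ^ 2) ≤ E₀ → (∀ x, ‖u 0 x‖ ≤ B₀) → ∀ t ∈ Set.Ico 0 T, ∀ x, ‖u t x‖ ≤ G E₀ B₀) → ∀ θ : ℝ, 0 < θ → ∃ F : ℝ → ℝ → ℝ, ∀ (u : ℝ → EuclideanSpace ℝ (Fin 3) → EuclideanSpace ℝ (Fin 3)) (p : ℝ → EuclideanSpace ℝ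 (Fin 3) → ℝ), Literature.Analysis.FluidPDE.IsClassicalNSSolutionOn (Set.Ico 0 T) ν 0 u p → Literature.Analysis.FluidPDE.IsLerayHopfOn T ν 0 (u 0) u → Literature.Analysis.FluidPDE.HasRapidSpatialDecay (u 0) → ∀ (E₀ B₀ : ℝ), (∫ x, ‖u 0 x‖ ^ 2) ≤ E₀ → (∀ x, ‖u 0 x‖ ≤ B₀) → ∀ (M c t : ℝ), 2 * (1 + θ) * B₀ ≤ M → M / 2 ≤ c → c ≤ M → 0 < c → t ∈ Set.Ico 0 T → -(∫ τ in Set.Ioo 0 t, ∫ x, max (1 - c / ‖u τ x‖) 0 * (fderiv ℝ (Literature.Analysis.FluidPDE.normalisedPressure (u τ)) x (u τ x))) ≤ Real.sqrt (F E₀ B₀ * (∫⁻ τ in Set.Ioo 0 T, MeasureTheory.volume {x | c < ‖u τ x‖}).toReal) * Real.sqrt (∫⁻ τ in Set.Ioo 0 T, ∫⁻ x, Set.indicator {x | c < ‖u τ x‖} (fun x => ENNReal.ofReal (‖fderiv ℝ (fun y => ‖u τ y‖) x‖ ^ 2)) x).toReal := by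
  intro ν T hν hT G hG θ hθ
  obtain ⟨Cₒ, hCₒ, hO⟩ := exists_norm_le_initial_add_of_speed_le
  obtain ⟨C, hC0, hP⟩ := levelSetModeration_exists_pressureSupBound_delay one_pos
  -- constants: `G₀ = max(G,|B₀|)+1`, `G' = max(G₀, Cₒ G₀²/(θ|B₀|)) + 1`,
  -- `K = G'²/3 + 8G'(C G'²/ν) + E₀⁺/(2π)`, `F = K²`
  refine ⟨fun E₀ B₀ =>
    ((max (max (G E₀ B₀) |B₀| + 1) (Cₒ * (max (G E₀ B₀) |B₀| + 1) ^ 2 / (θ * |B₀|)) + 1) ^ 2 / 3 +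
      8 * (max (max (G E₀ B₀) |B₀| + 1) (Cₒ * (max (G E₀ B₀) |B₀| + 1) ^ 2 / (θ * |B₀|)) + 1) *
        (C * (max (max (G E₀ B₀) |B₀| + 1) (Cₒ * (max (G E₀ B₀) |B₀| + 1) ^ 2 / (θ * |B₀|)) + 1) ^ 2 / ν) +
      max E₀ 0 / (2 * Real.pi)) ^ 2, ?_⟩
  intro u p hcl hLH hdec E₀ B₀ hE₀ hbd0 M c t hM hMc hcM hc ht
  set G₀ : ℝ := max (G E₀ B₀) |B₀| + 1 with hG₀
  set G' : ℝ := max G₀ (Cₒ * G₀ ^ 2 / (θ * |B₀|)) + 1 with hG'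
  set K : ℝ := G' ^ 2 / 3 + 8 * G' * (C * G' ^ 2 / ν) + max E₀ 0 / (2 * Real.pi) with hKdef
  have hG₀pos : 0 < G₀ := by
    rw [hG₀]; exact lt_of_le_of_lt (le_trans (abs_nonneg _) (le_max_right _ _)) (lt_add_one _)
  have hG'pos : 0 < G' := by
    rw [hG']; exact lt_of_le_of_lt (hG₀pos.le.trans (le_max_left _ _)) (lt_add_one _)
  have hG₀G' : G₀ ≤ G' := by rw [hG']; linarith [le_max_left G₀ (Cₒ * G₀ ^ 2 / (θ * |B₀|))]
  have hK0 : 0 ≤ K := by rw [hKdef]; positivity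
  have hbd : ∀ s ∈ Ico 0 T, ∀ x, ‖u s x‖ ≤ G₀ := fun s hs x =>
    (hG u p hcl hLH hdec E₀ B₀ hE₀ hbd0 s hs x).trans
      (by rw [hG₀]; linarith [le_max_left (G E₀ B₀) |B₀|])
  have hbdG' : ∀ s ∈ Ico 0 T, ∀ x, ‖u s x‖ ≤ G' := fun s hs x => (hbd s hs x).trans hG₀G'
  have hE₀' : (∫ x, ‖u 0 x‖ ^ 2) ≤ max E₀ 0 := hE₀.trans (le_max_left _ _)
  show -(∫ τ in Ioo 0 t, ∫ x, max (1 - c / ‖u τ x‖) 0 *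
      (fderiv ℝ (normalisedPressure (u τ)) x (u τ x))) ≤
    Real.sqrt (K ^ 2 * (∫⁻ τ in Ioo 0 T, volume {x | c < ‖u τ x‖}).toReal) *
      Real.sqrt ((∫⁻ τ in Ioo 0 T, ∫⁻ x, {x | c < ‖u τ x‖}.indicator
        (fun x => ENNReal.ofReal (‖fderiv ℝ (fun y => ‖u τ y‖) x‖ ^ 2)) x).toReal)
  refine levelSetModeration_pairing_le_of_pressureBound hν hT hcl hLH hdec hc le_rfl ht hK0 ?_
  intro τ hτ x hx
  have hτ' : τ ∈ Ico 0 T := ⟨hτ.1.le, hτ.2.trans ht.2⟩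
  -- the datum is not zero (else `u ≡ 0` and nothing is fast), so `B₀ > 0`
  have hB₀ : 0 < B₀ := by
    by_contra hB
    rw [not_lt] at hB
    have h0 : ∀ y, u 0 y = 0 := fun y => norm_le_zero_iff.1 ((hbd0 y).trans hB)
    have := levelSetModeration_slice_eq_zero_of_datum hcl hLH hν.le h0 hτ' x
    rw [this, norm_zero] at hx
    exact absurd hx (not_lt.2 hc.le)
  have hBabs : |B₀| = B₀ := abs_of_pos hB₀
  -- uniform `L²` bound of the slices (for the overshoot bound)
  set KK : ℝ≥0∞ := (ENNReal.ofReal (∫ x, ‖u 0 x‖ ^ 2)) ^ (1 / 2 : ℝ) with hKK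
  have hKKtop : KK ≠ ⊤ := ENNReal.rpow_ne_top_of_nonneg (by norm_num) ENNReal.ofReal_ne_top
  have hL2 : ∀ s ∈ Icc 0 T, s < T → eLpNorm (u s) 2 volume ≤ KK := by
    intro s hs _
    have h := lintegral_enorm_sq_le_of_lerayHopf hLH hν.le hs
    rw [eLpNorm_eq_lintegral_rpow_enorm_toReal (by norm_num) (by norm_num), ENNReal.toReal_ofNat, hKK]
    refine ENNReal.rpow_le_rpow ?_ (by norm_num)
    refine le_trans (le_of_eq ?_) h
    exact lintegral_congr fun x => by rw [ENNReal.rpow_two]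
  -- the overshoot bound at `τ` on the horizon `T'' = (τ + T)/2`: `(1+θ)B₀ < ‖u τ x‖ ≤ B₀ + Cₒ G₀² √(τ/ν)`
  set T'' : ℝ := (τ + T) / 2 with hT''
  have hT''pos : 0 < T'' := by rw [hT'']; linarith [hτ.1, hτ.2, ht.2]
  have hT''T : T'' < T := by rw [hT'']; linarith [hτ.2, ht.2]
  have hτT'' : τ < T'' := by rw [hT'']; linarith [hτ.2, ht.2]
  have hbd'' : ∀ s ∈ Icc 0 T'', ∀ y, ‖u s y‖ ≤ G₀ := fun s hs y => hbd s ⟨hs.1, hs.2.trans_lt hT''T⟩ y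
  have hover := hO hν hG₀pos hcl hT''pos hT''T hbd'' hKKtop
    (fun s hs => hL2 s ⟨hs.1, hs.2.trans hT''T.le⟩ (hs.2.trans_lt hT''T)) hbd0 τ ⟨hτ.1, hτT''⟩ x
  have hcθ : (1 + θ) * B₀ ≤ c := by linarith
  have hgap : θ * B₀ < Cₒ * G₀ ^ 2 * Real.sqrt (τ / ν) := by
    have h1 : (1 + θ) * B₀ < B₀ + Cₒ * G₀ ^ 2 * Real.sqrt (τ / ν) := lt_of_le_of_lt hcθ (hx.trans_le hover)
    linarith
  -- hence `τ > ν / G'²`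
  have hdelay : 1 * ν / G' ^ 2 < τ := by
    rw [one_mul]
    -- `G' ≥ Cₒ G₀²/(θ B₀)`, so `θ B₀ G' ≥ Cₒ G₀²`, and `θ B₀ < Cₒ G₀² √(τ/ν)` gives `1 < G' √(τ/ν)`
    have hG'ge : Cₒ * G₀ ^ 2 / (θ * B₀) ≤ G' := by
      rw [hG', hBabs]; linarith [le_max_right G₀ (Cₒ * G₀ ^ 2 / (θ * B₀))]
    have hθB : 0 < θ * B₀ := mul_pos hθ hB₀
    have h2 : Cₒ * G₀ ^ 2 ≤ θ * B₀ * G' := by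
      have := mul_le_mul_of_nonneg_left hG'ge hθB.le
      rwa [mul_div_cancel₀ _ hθB.ne'] at this
    have hsqrt_pos : 0 < Real.sqrt (τ / ν) := Real.sqrt_pos.2 (div_pos hτ.1 hν)
    have h3 : θ * B₀ < θ * B₀ * G' * Real.sqrt (τ / ν) := by
      calc θ * B₀ < Cₒ * G₀ ^ 2 * Real.sqrt (τ / ν) := hgap
        _ ≤ θ * B₀ * G' * Real.sqrt (τ / ν) := mul_le_mul_of_nonneg_right h2 hsqrt_pos.le
    have h4 : 1 < G' * Real.sqrt (τ / ν) := by
      refine lt_of_mul_lt_mul_left (a := θ * B₀) ?_ hθB.le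
      rw [mul_one]
      calc θ * B₀ < θ * B₀ * G' * Real.sqrt (τ / ν) := h3
        _ = θ * B₀ * (G' * Real.sqrt (τ / ν)) := by ring
    have h5 : 1 < G' ^ 2 * (τ / ν) := by
      have hsq := mul_self_lt_mul_self zero_le_one h4
      rw [one_mul] at hsq
      calc (1 : ℝ) < G' * Real.sqrt (τ / ν) * (G' * Real.sqrt (τ / ν)) := hsq
        _ = G' ^ 2 * (Real.sqrt (τ / ν) * Real.sqrt (τ / ν)) := by ring
        _ = G' ^ 2 * (τ / ν) := by rw [Real.mul_self_sqrt (div_pos hτ.1 hν).le]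
    have hG'2 : 0 < G' ^ 2 := by positivity
    rw [div_lt_iff₀ hG'2]
    have h6 : ν < G' ^ 2 * τ := by
      have h7 := mul_lt_mul_of_pos_right h5 hν
      rw [one_mul] at h7
      calc ν < G' ^ 2 * (τ / ν) * ν := h7
        _ = G' ^ 2 * τ := by field_simp
    linarith [mul_comm (G' ^ 2) τ]
  exact hP hν hT hG'pos hcl hLH hE₀' hbdG' τ ⟨hdelay, hτ'.2⟩ x

/-! ### `crux_θ ↔ UniformBound` -/

/-- **Every threshold above `2B₀` is exactly class-uniform boundedness.** For every `θ > 0`: the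
crux with window condition `2(1+θ)B₀ ≤ M` holds iff the class-uniform a priori speed bound holds
(`→`: area-law closure with datum bound `(1+θ)max(B₀,1)`; `←`:
`levelSetModeration_bookkeepingWithMargin` with `m = 0`). The crux as filed (`θ = 0`) differs
from quantitative regularity only through the level-set pairing at levels `c ↓ B₀ = sup|u₀|` in
the early time window. [folklore] -/
theorem levelSetModeration_highSpeedPressureWorkMargin_iff_uniformBound :
    ∀ θ : ℝ, 0 < θ → ((∀ (ν T : ℝ), 0 < ν → 0 < T → ∃ m : ℝ, m < 10 / 3 ∧ ∃ F : ℝ → ℝ → ℝ, ∀ (u : ℝ → EuclideanSpace ℝ (Fin 3) → EuclideanSpace ℝ (Fin 3)) (p : ℝ → EuclideanSpace ℝ (Fin 3) → ℝ), Literature.Analysis.FluidPDE.IsClassicalNSSolutionOn (Set.Ico 0 T) ν 0 u p → Literature.Analysis.FluidPDE.IsLerayHopfOn T ν 0 (u 0) u → Literature.Analysis.FluidPDE.HasRapidSpatialDecay (u 0) → ∀ (E₀ B₀ : ℝ), (∫ x, ‖u 0 x‖ ^ 2) ≤ E₀ → (∀ x, ‖u 0 x‖ ≤ B₀) → ∀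 (M c t : ℝ), 2 * (1 + θ) * B₀ ≤ M → M / 2 ≤ c → c ≤ M → 0 < c → t ∈ Set.Ico 0 T → -(∫ τ in Set.Ioo 0 t, ∫ x, max (1 - c / ‖u τ x‖) 0 * (fderiv ℝ (Literature.Analysis.FluidPDE.normalisedPressure (u τ)) x (u τ x))) ≤ Real.sqrt (F E₀ B₀ * M ^ m * (∫⁻ τ in Set.Ioo 0 T, MeasureTheory.volume {x | c < ‖u τ x‖}).toReal) * Real.sqrt (∫⁻ τ in Set.Ioo 0 T, ∫⁻ x, Set.indicator {x | c < ‖u τ x‖} (fun x => ENNReal.ofReal (‖fderiv ℝ (fun y => ‖u τ y‖) x‖ ^ 2)) x).toReal) ↔ (∀ (ν T : ℝ), 0 < ν → 0 < T → ∀ (E₀ B₀ : ℝ), ∃ G : ℝ, ∀ (u : ℝ → EuclideanSpace ℝ (Fin 3) → EuclideanSpace ℝ (Fin 3)) (p : ℝ → EuclideanSpace ℝ (Fin 3) → ℝ), Literature.Analysis.FluidPDE.IsClassicalNSSolutionOn (Set.Ico 0 T) ν 0 u p → Literature.Analysis.FluidPDE.IsLerayHopfOn T ν 0 (u 0) u →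 Literature.Analysis.FluidPDE.HasRapidSpatialDecay (u 0) → (∫ x, ‖u 0 x‖ ^ 2) ≤ E₀ → (∀ x, ‖u 0 x‖ ≤ B₀) → ∀ t ∈ Set.Ico 0 T, ∀ x, ‖u t x‖ ≤ G)) := by
  intro θ hθ
  constructor
  · -- `crux_θ → UniformBound`
    intro h4 ν T hν hT E₀ B₀
    obtain ⟨m, hm, F, hF⟩ := h4 ν T hν hT
    obtain ⟨C, hC, hrec⟩ := stub_linearLevelRecursion
    obtain ⟨κ, A₀, hκ, hA₀, hq⟩ := stub_occupationQuantum
    set B₁ : ℝ := max B₀ 1 with hB₁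
    have hB₁pos : 0 < B₁ := lt_of_lt_of_le one_pos (le_max_right _ _)
    have hm₁ : m / 2 < 5 / 3 := by linarith
    obtain ⟨G, hG⟩ := stub_areaLawClosure ν T (m / 2) (Real.sqrt (max (F E₀ B₁) 0)) E₀
      ((1 + θ) * B₁) C κ A₀ hν hT hm₁ hC hκ hA₀
    refine ⟨G, fun u p hcl hLH hdec hE hB => hG u p hcl hLH hdec hE ?_ ?_ ?_ ?_⟩
    · intro x
      have h1 : ‖u 0 x‖ ≤ B₁ := (hB x).trans (le_max_left _ _)
      nlinarith [norm_nonneg (u 0 x)]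
    · intro c hc
      exact hrec ν T u p hν hT hcl hLH hdec E₀ c hE hc
    · intro B' hB' hbd' T' G' hT' hG' hbd hpt
      exact hq ν T u p hν hT hcl hLH hdec B' hB' hbd' T' G' hT' hG' hbd hpt
    · intro M c hM hMc hcM hc
      have hMpos : 0 < M := by linarith
      have hB₁' : ∀ x, ‖u 0 x‖ ≤ B₁ := fun x => (hB x).trans (le_max_left _ _)
      have hu0 : ∀ x, ‖u 0 x‖ ≤ 2 * (1 + θ) * B₁ / 2 := fun x => by
        have := hB₁' x; nlinarith [norm_nonneg (u 0 x)]
      have hPW : ∀ (M' c' t : ℝ), 2 * (1 + θ) * B₁ ≤ M' → M' / 2 ≤ c' → c' ≤ M' → 0 < c' → t ∈ Ico 0 T →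
          -(∫ τ in Ioo 0 t, ∫ x, max (1 - c' / ‖u τ x‖) 0 *
              (fderiv ℝ (normalisedPressure (u τ)) x (u τ x))) ≤
            Real.sqrt (F E₀ B₁ * M' ^ m * (∫⁻ τ in Ioo 0 T, volume {x | c' < ‖u τ x‖}).toReal) *
            Real.sqrt ((∫⁻ τ in Ioo 0 T, ∫⁻ x, Set.indicator {x | c' < ‖u τ x‖}
              (fun x => ENNReal.ofReal (‖fderiv ℝ (fun y => ‖u τ y‖) x‖ ^ 2)) x).toReal) :=
        fun M' c' t hM' hMc' hcM' hc' ht => hF u p hcl hLH hdec E₀ B₁ hE hB₁' M' c' t hM' hMc' hcM' hc' ht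
      have hM4 : 2 * (1 + θ) * B₁ ≤ M := by linarith
      obtain ⟨hsqrt, -, -⟩ := levelSetEnergy_le_of_pairingBound
        levelSetModeration_levelSetEnergyInequality_proof hν hT hcl hLH hdec (M₀ := 2 * (1 + θ) * B₁)
        hu0 hPW hM4 hMc hcM hc
      have hVfin : (∫⁻ τ in Ioo 0 T, volume {x | c < ‖u τ x‖}) ≠ ⊤ :=
        ne_top_of_le_ne_top ENNReal.ofReal_ne_top (levelSetVolume_le hLH hν.le hT.le hc)
      have hDfin := (levelSetDissipation_ne_top hcl hLH hT hν.le hc.le).1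
      have hCS := levelSetModeration_isoSpeedArea_le_sqrt hcl.smooth_velocity hc (T := T)
      exact levelSetModeration_areaLaw_of_sqrtBound hν hMpos hVfin hDfin hCS hsqrt
  · -- `UniformBound → crux_θ`
    intro hU ν T hν hT
    choose G hG using fun E₀ B₀ => hU ν T hν hT E₀ B₀
    obtain ⟨F, hF⟩ := levelSetModeration_bookkeepingWithMargin ν T hν hT G
      (fun u p hcl hLH hdec E₀ B₀ hE hB => hG E₀ B₀ u p hcl hLH hdec hE hB) θ hθ
    refine ⟨0, by norm_num, F, ?_⟩
    intro u p hcl hLH hdec E₀ B₀ hE hB M c t hM hMc hcM hc ht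
    rw [Real.rpow_zero, mul_one]
    exact hF u p hcl hLH hdec E₀ B₀ hE hB M c t hM hMc hcM hc ht

end Summit.NavierStokesRegularity.NavierStokesRegularity.Theorems

end
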